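import Summits.QuantumAdvantage.AdviceFreeQNC0.SymmetricCount
import Summits.QuantumAdvantage.AdviceFreeQNC0.SPSRingFail
import HarnessLib

/-!
# Cell qa-qnc0 (rung F-Q1, density axis): the SYMMETRIC ORBIT-COUNTING ENGINE, part 2 — codewords of `C_m` in affine
# normal form, their point counts as binomial sums, and OPTIMALITY FROM A FINITE CHECK

* `SymCount.cwOf ℓ0 ℓ1` — the codeword with affine data `ℓ0 = (S0, α0)` on class 0, `ℓ1` on class 1, `ℓ0 ⊕ ℓ1` on class 2;
  `isElim1_cwOf` (it is in `C_m`) and **`exists_cwOf`** (every codeword of `C_m` is one — affine normal form of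
  degree-`≤ 1` functions, `SPSRingFail.exists_affEval_of_hasDeg_one`, plus evenness of the triple);
* `cwOf_eq_cwVal` — its value at `u` is `cwVal α0 α1 (block weights of u)`; hence **`card_filter_cwOf`** /
  **`failCount_cwOf`**: every count "codeword value & weight test" is the explicit binomial sum `G4 p q r s`;
* **`isOpt1_of_optCheck`** — `IsOpt1 m K0` follows from `failCount K0 = w` and the finite check `OptCheck m w`
  (`w ≤ G4q p q r s` for all `p + q + r + s = m` and all `α0, α1`), and `optCheck_of_slices` reduces the check to
  Boolean `p`-slices `optSliceB m w p` (structural `sumTo` / `allTo`, `Nat.ble`), which the kernel decides in seconds;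
* `symWord m b` — the symmetric codewords `(T₀, T₁, T₂) = (1, b ⊕ parity, ¬(b ⊕ parity))` (the optimum is `b = true`
  at m = 8, 9 and `b = false` at m = 14, 15): `isElim1_symWord`, `isSymPat_symWord`, `failCount_symWord`.

Instances (`w(8,1) = 45`, `w(9,1) = 90`, `w(15,1) = 8736`, MIChainFifteen's existence conjunct) are in `SymmetricOptima.lean`.
WHAT THIS IS NOT: nothing on MI / MULT₁; separation NOT moved.
-/

namespace Summit.QuantumAdvantage.AdviceFreeQNC0

open Finset

namespace SymCount

variable {m : ℕ}

/-! ### Codewords in affine normal form -/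

open Summit.QuantumAdvantage.AdviceFreeQNC0.MassInequality

/-- Parity bit of a natural number (kernel-friendly `Nat.beq` form). -/
def par (n : ℕ) : Bool := Nat.beq (n % 2) 1

/-- `par n` decides `n % 2 = 1`. -/
theorem par_eq_decide (n : ℕ) : par n = decide (n % 2 = 1) := by
  unfold par
  by_cases h : n % 2 = 1
  · rw [h]; rfl
  · have h' : n % 2 = 0 := by omega
    rw [h']; rfl

/-- The class selector: `T_c` for `c = |u| mod 3`, with `T_2 = T_0 ⊕ T_1` (kernel-friendly `Nat.beq` form). -/
def sel (c : ℕ) (t0 t1 : Bool) : Bool :=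
  bif Nat.beq c 0 then t0 else bif Nat.beq c 1 then t1 else xor t0 t1

/-- Class 0 selects `T₀`. -/
@[simp] theorem sel_zero (t0 t1 : Bool) : sel 0 t0 t1 = t0 := rfl
/-- Class 1 selects `T₁`. -/
@[simp] theorem sel_one (t0 t1 : Bool) : sel 1 t0 t1 = t1 := rfl
/-- Class 2 selects `T₀ ⊕ T₁`. -/
@[simp] theorem sel_two (t0 t1 : Bool) : sel 2 t0 t1 = xor t0 t1 := rfl

/-- `affEval` through `par`. -/
theorem affEval_eq_par (ℓ : Finset (Fin m) × Bool) (u : Fin m → Bool) :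
    affEval ℓ u = xor ℓ.2 (par (ℓ.1.filter fun i => u i = true).card) := by
  rw [par_eq_decide]; rfl

/-- Affine forms have degree `≤ 1` (`SPSApprox.ind_affEval_mem`). -/
theorem hasDeg_affEval (ℓ : Finset (Fin m) × Bool) : HasDeg (affEval ℓ) 1 :=
  SPSApprox.ind_affEval_mem ℓ

/-- The even triple with affine data `ℓ0` (class 0), `ℓ1` (class 1), `ℓ0 ⊕ ℓ1` (class 2). -/
def tripleOf (ℓ0 ℓ1 : Finset (Fin m) × Bool) (r : ℕ) (u : Fin m → Bool) : Bool :=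
  sel r (affEval ℓ0 u) (affEval ℓ1 u)

/-- The codeword with affine data `(ℓ0, ℓ1)`. -/
def cwOf (ℓ0 ℓ1 : Finset (Fin m) × Bool) (u : Fin m → Bool) : Bool := tripleOf ℓ0 ℓ1 (wt u % 3) u

/-- Each member of the triple is affine. -/
theorem hasDeg_tripleOf (ℓ0 ℓ1 : Finset (Fin m) × Bool) (r : ℕ) : HasDeg (tripleOf ℓ0 ℓ1 r) 1 := by
  unfold tripleOf
  rcases r with _ | _ | r
  · exact hasDeg_affEval ℓ0
  · exact hasDeg_affEval ℓ1
  · have h : (fun u => sel (r + 1 + 1) (affEval ℓ0 u) (affEval ℓ1 u)) =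
        fun u => xor (affEval ℓ0 u) (affEval ℓ1 u) := by
      funext u; rfl
    rw [h]; exact hasDeg_xor (hasDeg_affEval ℓ0) (hasDeg_affEval ℓ1)

/-- `cwOf ℓ0 ℓ1 ∈ C_m`. -/
theorem isElim1_cwOf (ℓ0 ℓ1 : Finset (Fin m) × Bool) : IsElim1 m (cwOf ℓ0 ℓ1) :=
  ⟨tripleOf ℓ0 ℓ1, hasDeg_tripleOf ℓ0 ℓ1, fun u => by
    simp only [tripleOf, sel_zero, sel_one, sel_two]
    cases affEval ℓ0 u <;> cases affEval ℓ1 u <;> decide, fun _ => rfl⟩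

/-- **Normal form**: every codeword of `C_m` is a `cwOf`. -/
theorem exists_cwOf {X : (Fin m → Bool) → Bool} (hX : IsElim1 m X) : ∃ ℓ0 ℓ1, X = cwOf ℓ0 ℓ1 := by
  obtain ⟨T, hT, heven, hXT⟩ := hX
  obtain ⟨ℓ0, h0⟩ := SPSRingFail.exists_affEval_of_hasDeg_one (hT 0)
  obtain ⟨ℓ1, h1⟩ := SPSRingFail.exists_affEval_of_hasDeg_one (hT 1)
  refine ⟨ℓ0, ℓ1, funext fun u => ?_⟩
  rw [hXT u]
  unfold cwOf tripleOf
  have h2 : T 2 u = xor (affEval ℓ0 u) (affEval ℓ1 u) := by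
    have := heven u
    rw [h0, h1] at this
    revert this
    cases T 2 u <;> cases affEval ℓ0 u <;> cases affEval ℓ1 u <;> decide
  have h3 : wt u % 3 = 0 ∨ wt u % 3 = 1 ∨ wt u % 3 = 2 := by omega
  rcases h3 with h | h | h
  · rw [h, sel_zero, h0]
  · rw [h, sel_one, h1]
  · rw [h, sel_two, h2]

/-- Value of `cwOf ((S0,α0),(S1,α1))` at a point with block weights `k = (k_tt, k_tf, k_ft, k_ff)`. -/
def cwVal (α0 α1 : Bool) (k : ℕ × ℕ × ℕ × ℕ) : Bool :=
  sel ((k.1 + k.2.1 + k.2.2.1 + k.2.2.2) % 3) (xor α0 (par (k.1 + k.2.1))) (xor α1 (par (k.1 + k.2.2.1)))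

/-- A codeword's value at `u` depends only on the four block weights of `u`. -/
theorem cwOf_eq_cwVal (ℓ0 ℓ1 : Finset (Fin m) × Bool) (u : Fin m → Bool) :
    cwOf ℓ0 ℓ1 u = cwVal ℓ0.2 ℓ1.2 (bw4 ℓ0.1 ℓ1.1 u) := by
  unfold cwOf tripleOf cwVal
  rw [affEval_eq_par, affEval_eq_par, card_filter_S0 ℓ0.1 ℓ1.1 u, card_filter_S1 ℓ0.1 ℓ1.1 u,
    wt_eq_bw_sum ℓ0.1 ℓ1.1 u]
  rfl

/-- **The counting formula**: the number of points where a codeword's value and block weights pass a test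
is the explicit binomial sum `G4`. -/
theorem card_filter_cwOf (ℓ0 ℓ1 : Finset (Fin m) × Bool) (ψ : Bool → ℕ × ℕ × ℕ × ℕ → Bool) :
    (univ.filter fun u : Fin m → Bool => ψ (cwOf ℓ0 ℓ1 u) (bw4 ℓ0.1 ℓ1.1 u) = true).card =
      G4 (bs ℓ0.1 ℓ1.1 (true, true)) (bs ℓ0.1 ℓ1.1 (true, false)) (bs ℓ0.1 ℓ1.1 (false, true))
        (bs ℓ0.1 ℓ1.1 (false, false)) (fun k => ψ (cwVal ℓ0.2 ℓ1.2 k) k) := by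
  rw [← sum_box4_eq_G4, ← card_filter_eq_sum_box4]
  congr 1
  ext u
  simp only [mem_filter, mem_univ, true_and, cwOf_eq_cwVal]

/-- `failCount` of a codeword as a binomial sum. -/
theorem failCount_cwOf (ℓ0 ℓ1 : Finset (Fin m) × Bool) :
    failCount (cwOf ℓ0 ℓ1) =
      G4 (bs ℓ0.1 ℓ1.1 (true, true)) (bs ℓ0.1 ℓ1.1 (true, false)) (bs ℓ0.1 ℓ1.1 (false, true))
        (bs ℓ0.1 ℓ1.1 (false, false)) (fun k => !cwVal ℓ0.2 ℓ1.2 k) := by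
  rw [← card_filter_cwOf ℓ0 ℓ1 (fun b _ => !b)]
  unfold failCount
  congr 1
  ext u
  simp only [mem_filter, mem_univ, true_and]
  cases cwOf ℓ0 ℓ1 u <;> simp

/-! ### Optimality from a finite check -/

/-- The finite check behind `IsOpt1`: every parameter choice gives `failCount ≥ w`. -/
def OptCheck (m w : ℕ) : Prop :=
  ∀ p ≤ m, ∀ q ≤ m - p, ∀ r ≤ m - p - q, ∀ a0 a1 : Bool,
    w ≤ G4q p q r (m - p - q - r) (fun k => !cwVal a0 a1 k)


/-- **Optimality from the finite check.** -/
theorem isOpt1_of_optCheck {m w : ℕ} (h : OptCheck m w) {K0 : (Fin m → Bool) → Bool}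
    (hK0 : IsElim1 m K0) (hw : failCount K0 = w) : IsOpt1 m K0 := by
  refine ⟨hK0, fun X hX => ?_⟩
  obtain ⟨ℓ0, ℓ1, rfl⟩ := exists_cwOf hX
  rw [hw, failCount_cwOf, ← G4q_eq]
  have hs := bs_sum ℓ0.1 ℓ1.1
  have := h (bs ℓ0.1 ℓ1.1 (true, true)) (by omega) (bs ℓ0.1 ℓ1.1 (true, false)) (by omega)
    (bs ℓ0.1 ℓ1.1 (false, true)) (by omega) ℓ0.2 ℓ1.2
  rwa [show m - bs ℓ0.1 ℓ1.1 (true, true) - bs ℓ0.1 ℓ1.1 (true, false) - bs ℓ0.1 ℓ1.1 (false, true) =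
    bs ℓ0.1 ℓ1.1 (false, false) by omega] at this

/-! ### The symmetric words `(1, parity ⊕ b, ¬parity ⊕ b)` -/

/-- The symmetric codeword `T₀ = 1`, `T₁ = b ⊕ parity`, `T₂ = ¬(b ⊕ parity)`; `b = true` is the optimum at
m = 8, 9 and `b = false` at m = 14, 15. -/
def symWord (m : ℕ) (b : Bool) : (Fin m → Bool) → Bool :=
  cwOf ((∅ : Finset (Fin m)), true) ((univ : Finset (Fin m)), b)

/-- `symWord m b ∈ C_m`. -/
theorem isElim1_symWord (m : ℕ) (b : Bool) : IsElim1 m (symWord m b) := isElim1_cwOf _ _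

/-- `symWord m b u` as a function of `wt u`. -/
theorem symWord_apply (b : Bool) (u : Fin m → Bool) :
    symWord m b u = sel (wt u % 3) true (xor b (par (wt u))) := by
  unfold symWord cwOf tripleOf
  rw [affEval_eq_par, affEval_eq_par]
  simp only [Finset.filter_empty, Finset.card_empty]
  rfl

/-- `symWord m b` is symmetric. -/
theorem isSymPat_symWord (m : ℕ) (b : Bool) : IsSymPat (symWord m b) := by
  intro u v h
  rw [symWord_apply, symWord_apply, h]

/-- Block sizes for `S0 = ∅`, `S1 = univ`: everything in block `(false, true)`. -/
theorem bs_empty_univ (m : ℕ) (bc : Bool × Bool) :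
    bs ((∅ : Finset (Fin m))) ((univ : Finset (Fin m))) bc = if bc = (false, true) then m else 0 := by
  unfold bs block lab
  by_cases h : bc = (false, true)
  · subst h
    simp
  · rw [if_neg h]
    rw [Finset.card_eq_zero, Finset.filter_eq_empty_iff]
    intro i _
    simpa using fun h' => h h'.symm

/-- `failCount (symWord m b)` as the binomial sum `G4q 0 0 m 0`. -/
theorem failCount_symWord (m : ℕ) (b : Bool) :
    failCount (symWord m b) = G4q 0 0 m 0 (fun k => !cwVal true b k) := by
  unfold symWord
  rw [failCount_cwOf, ← G4q_eq]
  simp only [bs_empty_univ]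
  simp

/-! ### Boolean reflection of the finite check (kernel-friendly) -/

/-- `Σ_{i<n} f i` by structural recursion. -/
def sumTo : ℕ → (ℕ → ℕ) → ℕ
  | 0, _ => 0
  | n + 1, f => sumTo n f + f n

/-- `sumTo` is the `Finset.range` sum. -/
theorem sumTo_eq (n : ℕ) (f : ℕ → ℕ) : sumTo n f = ∑ i ∈ range n, f i := by
  induction n with
  | zero => rfl
  | succ n ih => rw [sumTo, ih, sum_range_succ]

/-- `∀ i < n, g i` by structural recursion. -/
def allTo : ℕ → (ℕ → Bool) → Bool
  | 0, _ => true
  | n + 1, g => allTo n g && g n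

/-- `allTo` certifies a bounded universal statement. -/
theorem allTo_spec {n : ℕ} {g : ℕ → Bool} (h : allTo n g = true) : ∀ i < n, g i = true := by
  induction n with
  | zero => intro i hi; omega
  | succ n ih =>
    rw [allTo, Bool.and_eq_true] at h
    intro i hi
    by_cases hin : i < n
    · exact ih h.1 i hin
    · have : i = n := by omega
      subst this; exact h.2

/-- The hoisted binomial sum in recursive form. -/
def G4r (p q r s : ℕ) (φ : ℕ × ℕ × ℕ × ℕ → Bool) : ℕ :=
  sumTo (p + 1) fun k1 => qchoose p k1 * sumTo (q + 1) fun k2 => qchoose q k2 *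
    sumTo (r + 1) fun k3 => qchoose r k3 * sumTo (s + 1) fun k4 => bif φ (k1, k2, k3, k4) then qchoose s k4 else 0

/-- The recursive form equals the hoisted form. -/
theorem G4r_eq (p q r s : ℕ) (φ : ℕ × ℕ × ℕ × ℕ → Bool) : G4r p q r s φ = G4q p q r s φ := by
  unfold G4r G4q
  simp only [sumTo_eq]
  refine sum_congr rfl fun k1 _ => ?_
  congr 1
  refine sum_congr rfl fun k2 _ => ?_
  congr 1
  refine sum_congr rfl fun k3 _ => ?_
  congr 1
  refine sum_congr rfl fun k4 _ => ?_
  cases φ (k1, k2, k3, k4) <;> simp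

/-- One `p`-slice of the finite check, as a Boolean. -/
def optSliceB (m w p : ℕ) : Bool :=
  allTo (m + 1 - p) fun q => allTo (m + 1 - p - q) fun r =>
    Nat.ble w (G4r p q r (m - p - q - r) fun k => !cwVal false false k) &&
    Nat.ble w (G4r p q r (m - p - q - r) fun k => !cwVal false true k) &&
    Nat.ble w (G4r p q r (m - p - q - r) fun k => !cwVal true false k) &&
    Nat.ble w (G4r p q r (m - p - q - r) fun k => !cwVal true true k)

/-- The slices imply the check. -/
theorem optCheck_of_slices {m w : ℕ} (h : ∀ p ≤ m, optSliceB m w p = true) : OptCheck m w := by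
  intro p hp q hq r hr a0 a1
  have h1 := allTo_spec (h p hp) q (by omega)
  have h2 := allTo_spec h1 r (by omega)
  simp only [Bool.and_eq_true, Nat.ble_eq] at h2
  rw [← G4r_eq]
  obtain ⟨⟨⟨hff, hft⟩, htf⟩, htt⟩ := h2
  cases a0 <;> cases a1 <;> assumption

end SymCount

end Summit.QuantumAdvantage.AdviceFreeQNC0
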